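import Summits.HodgeConjecture.CorCM.IrreducibleOddWeightsShadowModules
import HarnessLib

/-!
# Shadow modules, II: DEFECT QUANTISATION for type ranks — `rank Φ₀ + rank Φ₁ − rank(Φ₀,Φ₁) − 1 ∈ {0, dim A₀}` when both
# shadows lie in irreducible modules, with interaction IFF an equivariant map carries one shadow to the other

COR-CM (cell `pub-hodgecm2`, binder seat `b16` gen 69, count-neutral claim ROW SPACES OVER THE COMMUTANT, file Q3b —
abstract `G`-set level; theorems only, no definition, no named fact, no `sorry`).  NEW as stated, hence under `Summits/`.
HONEST FRAMING: file Q3's meet theorem for translates of functions on finite `G`-sets, plugged into gen 68's two-sided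
shadow formula (P5 `IrreducibleOddWeightsIndexParityShadowPair` §1) for the Kubota–Dodson rank of a pair of CM types;
`HC_CM` is neither used nor asserted.

SETTING (Q3).  Two slots `E_{i₀}, E_{i₁}` with equivariant pivots `r_κ : E_{i_κ} → Y_κ` refining the trace classes; the
SHADOWS `w_κ(y) = Σ_{r_κ x = y} u_κ(x)`; stable IRREDUCIBLE modules `A_κ ≤ ℚ^{Y_κ}` containing them (e.g. the odd weights of
a pivot field with (IRR), gen 55).

* **`typeRank_add_typeRank_eq_or_eq_add_finrank_of_irreducible`**: `rank Φ₀ + rank Φ₁ = rank(Φ₀,Φ₁) + 1` (additive) OR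
  `= rank(Φ₀,Φ₁) + 1 + dim A₀` — the defect `dim Hg(A₀)+dim Hg(A₁)−dim Hg(A₀×A₁)` carried by irreducible shadow modules is
  `0` or `dim A₀`, never in between (census: 2 over quartic pivots, 4 over the octic (IRR) pivots of the (8,8) twins).
* **`typeRank_add_typeRank_ne_iff_of_irreducible`**: the pair INTERACTS iff `w₀ ≠ 0` and an EQUIVARIANT linear map,
  injective on `A₁` with `L(A₁) ⊆ A₀`, carries `w₁` to `w₀` — gen 55's criterion («no equivariant `L` with `L u₁ = u₀`»,
  one common irreducible slot) for two DIFFERENT fields and pivots, read on the shadows; no model and no absolute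
  irreducibility are assumed.

## References

* [Gordon1999HodgeAVSurvey] B. B. Gordon, *A survey of the Hodge conjecture for abelian varieties*, §3 Theorem (proof),
  7.5–7.7, 9.4.3.
* [Serre1977] J.-P. Serre, *Linear Representations of Finite Groups*, GTM 42, §2.2, §2.6.
-/

set_option autoImplicit false

noncomputable section

open scoped BigOperators Classical

universe u v v' v'' w

namespace Summit.HodgeConjecture.CorCM.IrrOdd

open Literature.NumberTheory.ComplexMultiplication

variable {G : Type w} [Group G] {Y₀ : Type v'} [MulAction G Y₀] [Fintype Y₀] [DecidableEq Y₀]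
  {Y₁ : Type v''} [MulAction G Y₁] [Fintype Y₁] [DecidableEq Y₁]

/-! ### §3 Defect quantisation -/

variable {I : Type u} {E : I → Type v} [∀ i, MulAction G (E i)] [∀ i, Fintype (E i)] [Fintype I] [∀ i, Nonempty (E i)]

/-- **DEFECT QUANTISATION.**  Two slots with equivariant pivots `r_κ : E_κ → Y_κ` refining the trace classes; if the
shadows `w_κ(y) = Σ_{r_κ x = y} u_κ(x)` lie in stable IRREDUCIBLE modules `A_κ ≤ ℚ^{Y_κ}` then
**`rank Φ₀ + rank Φ₁ = rank(Φ₀,Φ₁) + 1`** (additive) **or `= rank(Φ₀,Φ₁) + 1 + dim A₀`** — the defect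
`dim Hg(A₀)+dim Hg(A₁)−dim Hg(A₀×A₁)` is `0` or `dim A₀`, never in between.
[cite: Gordon1999HodgeAVSurvey, §3 Theorem, 7.5–7.7 and 9.4.3] [cite: Serre1977, §2.6] -/
theorem typeRank_add_typeRank_eq_or_eq_add_finrank_of_irreducible {ρ : G} {Φ : ∀ i, Set (E i)}
    (h : ∀ i, IsCMTypeWith ρ (Φ i)) {i₀ i₁ : I} (hI : ∀ j, j = i₀ ∨ j = i₁) (h01 : i₀ ≠ i₁)
    (r₀ : E i₀ → Y₀) (r₁ : E i₁ → Y₁) (hr₀ : ∀ (g : G) (x : E i₀), r₀ (g • x) = g • r₀ x)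
    (hr₁ : ∀ (g : G) (x : E i₁), r₁ (g • x) = g • r₁ x)
    (hfine₀ : ∀ x x' : E i₀, r₀ x = r₀ x' → ∃ n : G, (∀ y : E i₁, n • y = y) ∧ n • x = x')
    (hfine₁ : ∀ x x' : E i₁, r₁ x = r₁ x' → ∃ n : G, (∀ y : E i₀, n • y = y) ∧ n • x = x')
    {A₀ : Submodule ℚ (Y₀ → ℚ)} {A₁ : Submodule ℚ (Y₁ → ℚ)}
    (hAst₀ : ∀ (k : G) (a : Y₀ → ℚ), a ∈ A₀ → (fun y => a (k • y)) ∈ A₀)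
    (hirr₀ : ∀ W : Submodule ℚ (Y₀ → ℚ), W ≤ A₀ → W ≠ ⊥ →
      (∀ (k : G) (f : Y₀ → ℚ), f ∈ W → (fun y => f (k • y)) ∈ W) → W = A₀)
    (hAst₁ : ∀ (k : G) (a : Y₁ → ℚ), a ∈ A₁ → (fun y => a (k • y)) ∈ A₁)
    (hirr₁ : ∀ W : Submodule ℚ (Y₁ → ℚ), W ≤ A₁ → W ≠ ⊥ →
      (∀ (k : G) (f : Y₁ → ℚ), f ∈ W → (fun y => f (k • y)) ∈ W) → W = A₁)
    (hw₀A : (fun y : Y₀ => ∑ x ∈ Finset.univ.filter (fun x => r₀ x = y), antiVec (Φ i₀) (1 : G) x) ∈ A₀)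
    (hw₁A : (fun y : Y₁ => ∑ x ∈ Finset.univ.filter (fun x => r₁ x = y), antiVec (Φ i₁) (1 : G) x) ∈ A₁) :
    typeRank G (Φ i₀) + typeRank G (Φ i₁) = typeRank G (sigmaType Φ) + 1 ∨
      typeRank G (Φ i₀) + typeRank G (Φ i₁) = typeRank G (sigmaType Φ) + 1 + Module.finrank ℚ A₀ := by
  have hpair := typeRank_add_typeRank_eq_add_finrank_shadowCoeff_inf_shadowCoeff_of_fine h hI h01 r₀ r₁ hr₀ hr₁
    hfine₀ hfine₁
  have key := finrank_span_shadowCoeff_inf_eq_zero_or_eq (G := G) hAst₀ hirr₀ hAst₁ hirr₁ hw₀A hw₁A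
  beta_reduce at key
  rcases key with h0 | hA
  · left
    rw [h0, add_zero] at hpair
    exact hpair
  · right
    rw [hA] at hpair
    exact hpair

/-- **INTERACTION CRITERION (type ranks).**  Under the same hypotheses the pair INTERACTS
(`rank Φ₀ + rank Φ₁ ≠ rank(Φ₀,Φ₁) + 1`) IFF the shadow `w₀` is non-zero and an equivariant `L`, injective on `A₁` with
`L(A₁) ⊆ A₀`, carries `w₁` to `w₀`. [cite: Gordon1999HodgeAVSurvey, §3 Theorem, 7.5–7.7] [cite: Serre1977, §2.2] -/
theorem typeRank_add_typeRank_ne_iff_of_irreducible {ρ : G} {Φ : ∀ i, Set (E i)}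
    (h : ∀ i, IsCMTypeWith ρ (Φ i)) {i₀ i₁ : I} (hI : ∀ j, j = i₀ ∨ j = i₁) (h01 : i₀ ≠ i₁)
    (r₀ : E i₀ → Y₀) (r₁ : E i₁ → Y₁) (hr₀ : ∀ (g : G) (x : E i₀), r₀ (g • x) = g • r₀ x)
    (hr₁ : ∀ (g : G) (x : E i₁), r₁ (g • x) = g • r₁ x)
    (hfine₀ : ∀ x x' : E i₀, r₀ x = r₀ x' → ∃ n : G, (∀ y : E i₁, n • y = y) ∧ n • x = x')
    (hfine₁ : ∀ x x' : E i₁, r₁ x = r₁ x' → ∃ n : G, (∀ y : E i₀, n • y = y) ∧ n • x = x')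
    {A₀ : Submodule ℚ (Y₀ → ℚ)} {A₁ : Submodule ℚ (Y₁ → ℚ)}
    (hAst₀ : ∀ (k : G) (a : Y₀ → ℚ), a ∈ A₀ → (fun y => a (k • y)) ∈ A₀)
    (hirr₀ : ∀ W : Submodule ℚ (Y₀ → ℚ), W ≤ A₀ → W ≠ ⊥ →
      (∀ (k : G) (f : Y₀ → ℚ), f ∈ W → (fun y => f (k • y)) ∈ W) → W = A₀)
    (hAst₁ : ∀ (k : G) (a : Y₁ → ℚ), a ∈ A₁ → (fun y => a (k • y)) ∈ A₁)
    (hirr₁ : ∀ W : Submodule ℚ (Y₁ → ℚ), W ≤ A₁ → W ≠ ⊥ →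
      (∀ (k : G) (f : Y₁ → ℚ), f ∈ W → (fun y => f (k • y)) ∈ W) → W = A₁)
    (hw₀A : (fun y : Y₀ => ∑ x ∈ Finset.univ.filter (fun x => r₀ x = y), antiVec (Φ i₀) (1 : G) x) ∈ A₀)
    (hw₁A : (fun y : Y₁ => ∑ x ∈ Finset.univ.filter (fun x => r₁ x = y), antiVec (Φ i₁) (1 : G) x) ∈ A₁) :
    typeRank G (Φ i₀) + typeRank G (Φ i₁) ≠ typeRank G (sigmaType Φ) + 1 ↔
      (fun y : Y₀ => ∑ x ∈ Finset.univ.filter (fun x => r₀ x = y), antiVec (Φ i₀) (1 : G) x) ≠ 0 ∧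
        ∃ L : (Y₁ → ℚ) →ₗ[ℚ] (Y₀ → ℚ), (∀ f ∈ A₁, L f ∈ A₀) ∧ (∀ f ∈ A₁, L f = 0 → f = 0) ∧
          (∀ (k : G) (f : Y₁ → ℚ), f ∈ A₁ → L (fun y => f (k • y)) = fun y => L f (k • y)) ∧
          L (fun y : Y₁ => ∑ x ∈ Finset.univ.filter (fun x => r₁ x = y), antiVec (Φ i₁) (1 : G) x) =
            fun y : Y₀ => ∑ x ∈ Finset.univ.filter (fun x => r₀ x = y), antiVec (Φ i₀) (1 : G) x := by
  have hpair := typeRank_add_typeRank_eq_add_finrank_shadowCoeff_inf_shadowCoeff_of_fine h hI h01 r₀ r₁ hr₀ hr₁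
    hfine₀ hfine₁
  have key := span_shadowCoeff_inf_ne_bot_iff (G := G) hAst₀ hirr₀ hAst₁ hirr₁ hw₀A hw₁A
  beta_reduce at key
  rw [← key]
  haveI : FiniteDimensional ℚ (Submodule.span ℚ (Set.range fun y : Y₀ => fun g : G =>
      ∑ x ∈ Finset.univ.filter (fun x => r₀ x = g • y), antiVec (Φ i₀) (1 : G) x)) :=
    FiniteDimensional.span_of_finite ℚ (Set.finite_range _)
  rw [Ne, Ne, ← Submodule.finrank_eq_zero]
  omega

end Summit.HodgeConjecture.CorCM.IrrOdd

end
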